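import Mathlib
import Summits.Ventures.HodgeRepro2.T5HeckeDoubleCoset

/-!
# Matrix coefficients of Hecke operators between `K`-fixed vectors

Blind cell `pub-hodge-repro2`, seat p8 (gen 8), Tier-5 kernel support.  The period / matrix-coefficient
bookkeeping of the N1 / N4 / N5 rows (route/T5-CHECK-N3-p8.md §13.1 row 5) pairs `K`-fixed vectors
with `K`-fixed functionals.  For the double-coset operators of `T5HeckeDoubleCoset` (T5-53) this
bookkeeping collapses to a single matrix coefficient:

* `apply_orbitMap_eq` — for `l ∈ (V^*)^K` and `v ∈ V^K`, `x ↦ l(ρ(x) v)` is constant on the double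
  coset `KgK`;
* `apply_heckeSMul_doubleCosetOp` — `⟨l, T_g • v⟩ = #(KgK/K) · ⟨l, ρ(g) v⟩`;
* `apply_heckeOp` — `⟨l, e_K ρ(g) e_K v⟩ = ⟨l, ρ(g) v⟩` (characteristic `0`, `ρ` `K`-finite): the
  matrix coefficient of T5-46's operator between `K`-fixed vectors is the matrix coefficient of
  `ρ(g)` itself — no normalisation enters.

README §8(d): uses an L-value-free non-vanishing device: NO.
-/

namespace Summit.Ventures.HodgeRepro2.T5HeckeMatrixCoefficient

noncomputable section

open Summit.Ventures.HodgeRepro2.LevelPositivity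
open Summit.Ventures.HodgeRepro2.T5LevelIdempotent
open Summit.Ventures.HodgeRepro2.T5HeckeOperator
open Summit.Ventures.HodgeRepro2.T5HeckePermutationModule
open Summit.Ventures.HodgeRepro2.T5HeckeDoubleCoset
open MulAction

variable {G : Type*} [Group G] {k : Type*} [Field k] {V : Type*} [AddCommGroup V] [Module k V]
  (ρ : Representation k G V) {K : Subgroup G}

/-- A `K`-fixed functional is insensitive to `K` on the left: `l (ρ κ u) = l u`. -/
theorem apply_rep_eq_of_mem_invariants_dual {l : Module.Dual k V} (hl : l ∈ invariants ρ.dual K)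
    {κ : G} (hκ : κ ∈ K) (u : V) : l (ρ κ u) = l u := by
  have h := mem_invariants_iff.mp hl κ⁻¹ (inv_mem hκ)
  have h' := congrArg (fun f : Module.Dual k V => f u) h
  simpa [Representation.dual_apply, Module.Dual.transpose_apply] using h'

/-- For `l ∈ (V^*)^K` and `v ∈ V^K`, `x ↦ l (ρ(x) v)` is constant on the `K`-orbit of `gK`. -/
theorem apply_orbitMap_eq {l : Module.Dual k V} (hl : l ∈ invariants ρ.dual K) {v : V}
    (hv : v ∈ invariants ρ K) (g : G) {x : G ⧸ K} (hx : x ∈ orbit K (g : G ⧸ K)) :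
    l (orbitMap ρ v hv x) = l (ρ g v) := by
  obtain ⟨κ, rfl⟩ := mem_orbit_iff.mp hx
  change l (orbitMap ρ v hv ((((κ : G) * g : G)) : G ⧸ K)) = _
  rw [orbitMap_mk, map_mul, Module.End.mul_apply, apply_rep_eq_of_mem_invariants_dual ρ hl κ.2]

/-- `⟨l, T_g • v⟩ = #(KgK/K) · ⟨l, ρ(g) v⟩` for `l ∈ (V^*)^K`, `v ∈ V^K`. -/
theorem apply_heckeSMul_doubleCosetOp {l : Module.Dual k V} (hl : l ∈ invariants ρ.dual K)
    (g : G) [Finite (orbit K (g : G ⧸ K))] (v : invariants ρ K) :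
    l (heckeSMul ρ (doubleCosetOp k K g) v) = ((orbit K (g : G ⧸ K)).ncard : k) * l (ρ g v) := by
  rw [heckeSMul_doubleCosetOp, finsum_mem_eq_finite_toFinset_sum _ (Set.toFinite _), map_sum,
    Finset.sum_congr rfl fun x hx => apply_orbitMap_eq ρ hl v.2 g ((Set.Finite.mem_toFinset _).mp hx),
    Finset.sum_const, Set.ncard_eq_toFinset_card _ (Set.toFinite _), nsmul_eq_mul]

/-- `⟨l, e_K ρ(g) e_K v⟩ = ⟨l, ρ(g) v⟩` for `l ∈ (V^*)^K`, `v ∈ V^K` (characteristic `0`, `ρ`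
`K`-finite, `KgK/K` finite): the Hecke operator of T5-46 has the matrix coefficient of `ρ(g)` itself. -/
theorem apply_heckeOp [CharZero k] (hK : KFinite ρ K) {l : Module.Dual k V}
    (hl : l ∈ invariants ρ.dual K) (g : G) [Finite (orbit K (g : G ⧸ K))] (v : invariants ρ K) :
    l (heckeOp ρ hK g v) = l (ρ g v) := by
  have hn : ((orbit K (g : G ⧸ K)).ncard : k) ≠ 0 := by
    exact_mod_cast ((Set.ncard_pos (Set.toFinite _)).mpr ⟨_, mem_orbit_self _⟩).ne'
  rw [heckeOp_eq_inv_ncard_smul, Submodule.coe_smul, map_smul, apply_heckeSMul_doubleCosetOp ρ hl g v,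
    smul_eq_mul, ← mul_assoc, inv_mul_cancel₀ hn, one_mul]

end

end Summit.Ventures.HodgeRepro2.T5HeckeMatrixCoefficient
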